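import Mathlib
import Literature.Computability.AlgebraicComplexity.GroupTheoreticMatMul
import Summits.MatrixMultiplication.MatrixMultiplication.Theorems.GroupTheoreticSTPPCThesisPackingSumset
import Summits.MatrixMultiplication.MatrixMultiplication.Theorems.AbelianSTPPCensusIteratedRoom

/-!
# Difference-set disjointness across members of a near-tight STPP family (cell mm-stpp, theory g9)

A two-member STRUCTURAL consequence of the room lemma for census-STPP families (`IsSTPP`, CKSU 2005 Def. 5.1) in a
finite abelian group `G`: let `t ≠ u` be members, `s` a bound for the C-form U14 slack of `t`
(`|G| ≤ V_t + Σ_{w ≠ t} |A_w||B_w| + s`, `V_t = |A_t||B_t||C_t|`).  **If `|A_u||B_u| > 2s` then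
`(C_t − C_t) ∩ (C_u − C_u) = {0}`** (`sub_sub_inter_sub_sub_subset`; only the `C_w` need be non-empty): the difference sets of the `C`-blocks of two
members share no non-zero element.  Proof: for `p ∈ (C_t − C_t) ∩ (C_u − C_u)`, `p ≠ 0`, the translate
`(A_u − B_u) + p` avoids every block `A_w − B_w` (TPP of `u` and the room pattern `(w,u,u)`), so — reading `G` through the
window `G = (W_t − c₀) ⊔ ⊔_{w≠t}(A_w − B_w) ⊔ S` with `|S| ≤ s` (U14⁺, `STPPPackingSumset`) — it has at most `s` points
outside `W_t − c₀`, and at most `s` points inside, because `A_u − B_u` itself avoids `W_t − c₀` and `p` is an `s`-popular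
difference of `W_t` (`STPPIteratedRoom.room_popular`): `|A_u||B_u| ≤ 2s`.  The `B`-version (`(B_t − B_t) ∩ (B_u − B_u) = {0}`
under the `Σ|C_w||A_w|`-slack) follows by `IsSTPP.rotate`; the `A`-version needs `|B_u||C_u| > 2 s_A` and is recorded too.
At the first alive object of the census (abelian order 338, shapes `(7,5,5)+(6,6,6)³`: `s = 15` in the C- and B-rooms of every
`(6,6,6)` member, blocks of size `36, 36, 36, 35 > 30`) this gives: **the four sets `C_u − C_u` meet pairwise only in `0`, and so do the
four sets `B_u − B_u`** (`pairwise_C_338`-type instances are left to the census files; the general lemma is the content here).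
WHAT THIS IS NOT: no `ω` statement, no exclusion of any list; a necessary condition of a new (two-member, structural) kind.
-/

-- single-conjunct summit: the mandated namespace repeats `MatrixMultiplication`.
set_option linter.dupNamespace false

namespace Summit.MatrixMultiplication.MatrixMultiplication.Theorems

namespace STPPDifferenceDisjoint

open Finset Literature.Computability.AlgebraicComplexity
open scoped Pointwise

variable {G : Type*} [AddCommGroup G] [DecidableEq G] [Fintype G] {N : ℕ} {A B C : Fin N → Finset G}

omit [Fintype G] in
/-- TPP of member `u`: a non-trivial `C_u`-difference never maps the block `A_u − B_u` into itself:
if `c₁ ≠ c₂ ∈ C_u` then `(A_u − B_u) ∩ ((A_u − B_u) + (c₁ − c₂)) = ∅`. [cite: CohnKleinbergSzegedyUmans2005, Def. 5.1] -/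
theorem not_mem_sub_of_mem_sub_add (h : IsSTPP A B C) (u : Fin N) {c₁ c₂ : G} (hc₁ : c₁ ∈ C u) (hc₂ : c₂ ∈ C u)
    (hne : c₁ ≠ c₂) {d : G} (hd : d ∈ A u - B u) : d + (c₁ - c₂) ∉ A u - B u := by
  intro hd'
  rw [mem_sub] at hd hd'
  obtain ⟨a, ha, b, hb, rfl⟩ := hd
  obtain ⟨a', ha', b', hb', he⟩ := hd'
  have key : (a' - a) + (b - b') + (c₂ - c₁) = 0 := by
    have : a' - b' = a - b + (c₁ - c₂) := he
    have e2 : a' = a - b + (c₁ - c₂) + b' := by rw [← this]; abel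
    rw [e2]; abel
  obtain ⟨-, -, -, -, hcc⟩ := h u u u a ha a' ha' b' hb' b hb c₁ hc₁ c₂ hc₂ key
  exact hne hcc

/-- **Difference-set disjointness (C-form).**  `IsSTPP` family with all sets non-empty in a finite abelian group, members
`t ≠ u`, `s` with `|G| ≤ V_t + Σ_{w≠t}|A_w||B_w| + s` and `2s < |A_u||B_u|`: every common element of `C_t − C_t` and
`C_u − C_u` is `0`. [original] -/
theorem sub_sub_inter_sub_sub_subset (h : IsSTPP A B C) (hC : ∀ w, (C w).Nonempty) {t u : Fin N} (htu : t ≠ u) (s : ℕ)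
    (hs : Fintype.card G ≤ (A t).card * (B t).card * (C t).card +
      (∑ w ∈ univ.erase t, (A w).card * (B w).card) + s)
    (hbig : 2 * s < (A u).card * (B u).card) :
    ∀ p ∈ (C t - C t) ∩ (C u - C u), p = 0 := by
  classical
  intro p hp
  rw [mem_inter] at hp
  obtain ⟨hpt, hpu⟩ := hp
  by_contra hp0
  -- write `p = c₁ − c₂` with `c₁ ≠ c₂` in `C_u`
  rw [mem_sub] at hpu
  obtain ⟨c₁, hc₁, c₂, hc₂, rfl⟩ := hpu
  have hne : c₁ ≠ c₂ := fun e => hp0 (by rw [e, sub_self])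
  obtain ⟨c₀, hc₀⟩ := hC t
  set W : Finset G := A t - B t + C t with hW
  have hV : W.card = (A t).card * (B t).card * (C t).card := STPPIteratedRoom.card_sub_add_eq h t
  -- the window: `U` = the other blocks translated by `c₀`, disjoint from `W`
  set U : Finset G := ((univ.erase t).biUnion fun w => A w - B w).image (· + c₀) with hU
  have hUcard : U.card = ∑ w ∈ univ.erase t, (A w).card * (B w).card := by
    rw [hU, card_image_of_injective _ (add_left_injective c₀), card_biUnion]
    · exact sum_congr rfl fun w _ => STPPPackingSumset.card_sub_eq h w (hC w)
    · intro w _ w' _ hww'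
      exact STPPPackingSumset.disjoint_sub_sub h hww' (hC w')
  -- membership in `W` after removing `c₀` lands in the room set of `t`
  have hroom : ∀ x ∈ W, x - c₀ ∈ (A t - B t) + (C t - C t) := by
    intro x hx
    rw [hW, mem_add] at hx
    obtain ⟨y, hy, c, hc, rfl⟩ := hx
    rw [mem_add]
    exact ⟨y, hy, c - c₀, sub_mem_sub hc hc₀, by abel⟩
  have hUW : Disjoint U W := by
    rw [disjoint_left]
    intro x hxU hxW
    rw [hU, mem_image] at hxU
    obtain ⟨d, hd, rfl⟩ := hxU
    rw [mem_biUnion] at hd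
    obtain ⟨w, hw, hdw⟩ := hd
    have hwt : w ≠ t := (mem_erase.1 hw).1
    have := hroom _ hxW
    rw [add_sub_cancel_right] at this
    exact disjoint_left.1 (STPPPackingSumset.disjoint_sub_sumset h hwt) hdw this
  -- the translate `Z = (A_u − B_u) + (p + c₀)`
  set Z : Finset G := (A u - B u).image (· + (c₁ - c₂ + c₀)) with hZ
  have hZcard : Z.card = (A u).card * (B u).card := by
    rw [hZ, card_image_of_injective _ (add_left_injective _), STPPPackingSumset.card_sub_eq h u (hC u)]
  -- `Z` avoids `U`
  have hZU : Disjoint Z U := by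
    rw [disjoint_left]
    intro x hxZ hxU
    rw [hZ, mem_image] at hxZ
    obtain ⟨d, hd, rfl⟩ := hxZ
    rw [hU, mem_image] at hxU
    obtain ⟨d', hd', he⟩ := hxU
    rw [mem_biUnion] at hd'
    obtain ⟨w, hw, hdw⟩ := hd'
    have he' : d' = d + (c₁ - c₂) := by
      have := congrArg (· - c₀) he
      simp only [add_sub_cancel_right] at this
      rw [this]; abel
    rw [he'] at hdw
    by_cases hwu : w = u
    · subst hwu
      exact not_mem_sub_of_mem_sub_add h w hc₁ hc₂ hne hd hdw
    · have hmem : d + (c₁ - c₂) ∈ (A u - B u) + (C u - C u) :=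
        mem_add.2 ⟨d, hd, c₁ - c₂, sub_mem_sub hc₁ hc₂, rfl⟩
      exact disjoint_left.1 (STPPPackingSumset.disjoint_sub_sumset h hwu) hdw hmem
  -- `Z ∩ W` lies in the deficient part of the popular difference `p`
  have hZW : Z ∩ W ⊆ W.filter (fun w => ¬ (w - (c₁ - c₂) ∈ W)) := by
    intro x hx
    rw [mem_inter] at hx
    obtain ⟨hxZ, hxW⟩ := hx
    rw [mem_filter]
    refine ⟨hxW, fun hback => ?_⟩
    rw [hZ, mem_image] at hxZ
    obtain ⟨d, hd, rfl⟩ := hxZ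
    have e : d + (c₁ - c₂ + c₀) - (c₁ - c₂) = d + c₀ := by abel
    rw [e] at hback
    have := hroom _ hback
    rw [add_sub_cancel_right] at this
    exact disjoint_left.1 (STPPPackingSumset.disjoint_sub_sumset h htu.symm) hd this
  have hpop := STPPIteratedRoom.room_popular h hC t s hs (c₁ - c₂) hpt
  have hsplit := Finset.card_filter_add_card_filter_not (s := W) (fun w => w - (c₁ - c₂) ∈ W)
  have h1 : (Z ∩ W).card ≤ s := by
    have := card_le_card hZW
    rw [← hW] at hpop
    omega
  -- `Z \ W` lies in the complement of `W ∪ U`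
  have h2 : (Z \ W).card ≤ s := by
    have hsub : Z \ W ⊆ (W ∪ U)ᶜ := by
      intro x hx
      rw [mem_sdiff] at hx
      rw [mem_compl, mem_union, not_or]
      exact ⟨hx.2, fun hxU => disjoint_left.1 hZU hx.1 hxU⟩
    have hc := card_le_card hsub
    rw [card_compl, card_union_of_disjoint hUW.symm, hV, hUcard] at hc
    omega
  have h3 : Z.card = (Z ∩ W).card + (Z \ W).card := (card_inter_add_card_sdiff Z W).symm
  omega

/-- **Difference-set disjointness, B-form** (rotation `(A,B,C) ↦ (C,A,B)`): with `|G| ≤ V_t + Σ_{w≠t}|C_w||A_w| + s` and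
`2s < |C_u||A_u|`, every common element of `B_t − B_t` and `B_u − B_u` is `0`. [original] -/
theorem sub_sub_inter_sub_sub_subset_B (h : IsSTPP A B C) (hB : ∀ w, (B w).Nonempty) {t u : Fin N} (htu : t ≠ u) (s : ℕ)
    (hs : Fintype.card G ≤ (A t).card * (B t).card * (C t).card +
      (∑ w ∈ univ.erase t, (C w).card * (A w).card) + s)
    (hbig : 2 * s < (C u).card * (A u).card) :
    ∀ p ∈ (B t - B t) ∩ (B u - B u), p = 0 := by
  have e : (C t).card * (A t).card * (B t).card = (A t).card * (B t).card * (C t).card := by ring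
  exact sub_sub_inter_sub_sub_subset h.rotate.rotate hB htu s (by rw [e]; exact hs) hbig

/-- **Difference-set disjointness, A-form** (rotation `(A,B,C) ↦ (B,C,A)`): with `|G| ≤ V_t + Σ_{w≠t}|B_w||C_w| + s` and
`2s < |B_u||C_u|`, every common element of `A_t − A_t` and `A_u − A_u` is `0`. [original] -/
theorem sub_sub_inter_sub_sub_subset_A (h : IsSTPP A B C) (hA : ∀ w, (A w).Nonempty) {t u : Fin N} (htu : t ≠ u) (s : ℕ)
    (hs : Fintype.card G ≤ (A t).card * (B t).card * (C t).card +
      (∑ w ∈ univ.erase t, (B w).card * (C w).card) + s)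
    (hbig : 2 * s < (B u).card * (C u).card) :
    ∀ p ∈ (A t - A t) ∩ (A u - A u), p = 0 := by
  have e : (B t).card * (C t).card * (A t).card = (A t).card * (B t).card * (C t).card := by ring
  exact sub_sub_inter_sub_sub_subset h.rotate hA htu s (by rw [e]; exact hs) hbig

/-! ## Several members at once: a common non-zero difference of `C_t` and of every `C_u`, `u ∈ U`, costs `Σ_{u∈U} |A_u||B_u| ≤ 2s` -/

/-- **Common differences across several members.**  `IsSTPP` family with non-empty C-sets, member `t`, a set `U` of other
members, `s` with `|G| ≤ V_t + Σ_{w≠t}|A_w||B_w| + s`.  If a NON-ZERO `p` lies in `C_t − C_t` and in `C_u − C_u` for every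
`u ∈ U`, then `Σ_{u∈U} |A_u||B_u| ≤ 2s` (the translates `(A_u − B_u) + p`, `u ∈ U`, are pairwise disjoint, avoid every block,
and each has `≤ s` points inside and all together `≤ s` points outside the window `W_t − c₀`).  With `U = {u}` this is
`sub_sub_inter_sub_sub_subset`; at order 338 with `U` = two `(6,6,6)` members it says (A-form, `s = 25`): no non-zero element is
a common difference of three of the four sets `A_u`. [original] -/
theorem sum_card_mul_le_of_common_difference (h : IsSTPP A B C) (hC : ∀ w, (C w).Nonempty) (t : Fin N)
    (U : Finset (Fin N)) (htU : t ∉ U) (s : ℕ)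
    (hs : Fintype.card G ≤ (A t).card * (B t).card * (C t).card +
      (∑ w ∈ univ.erase t, (A w).card * (B w).card) + s)
    {p : G} (hp0 : p ≠ 0) (hpt : p ∈ C t - C t) (hpU : ∀ u ∈ U, p ∈ C u - C u) :
    ∑ u ∈ U, (A u).card * (B u).card ≤ 2 * s := by
  classical
  obtain ⟨c₀, hc₀⟩ := hC t
  set W : Finset G := A t - B t + C t with hW
  have hV : W.card = (A t).card * (B t).card * (C t).card := STPPIteratedRoom.card_sub_add_eq h t
  -- the window complement: the other blocks translated by `c₀`
  set X : Finset G := ((univ.erase t).biUnion fun w => A w - B w).image (· + c₀) with hX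
  have hXcard : X.card = ∑ w ∈ univ.erase t, (A w).card * (B w).card := by
    rw [hX, card_image_of_injective _ (add_left_injective c₀), card_biUnion]
    · exact sum_congr rfl fun w _ => STPPPackingSumset.card_sub_eq h w (hC w)
    · intro w _ w' _ hww'
      exact STPPPackingSumset.disjoint_sub_sub h hww' (hC w')
  have hroom : ∀ x ∈ W, x - c₀ ∈ (A t - B t) + (C t - C t) := by
    intro x hx
    rw [hW, mem_add] at hx
    obtain ⟨y, hy, c, hc, rfl⟩ := hx
    rw [mem_add]
    exact ⟨y, hy, c - c₀, sub_mem_sub hc hc₀, by abel⟩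
  have hXW : Disjoint X W := by
    rw [disjoint_left]
    intro x hxX hxW
    rw [hX, mem_image] at hxX
    obtain ⟨d, hd, rfl⟩ := hxX
    rw [mem_biUnion] at hd
    obtain ⟨w, hw, hdw⟩ := hd
    have hwt : w ≠ t := (mem_erase.1 hw).1
    have := hroom _ hxW
    rw [add_sub_cancel_right] at this
    exact disjoint_left.1 (STPPPackingSumset.disjoint_sub_sumset h hwt) hdw this
  -- the union of the translates `(A_u − B_u) + (p + c₀)`, `u ∈ U`
  set Z : Finset G := (U.biUnion fun u => A u - B u).image (· + (p + c₀)) with hZ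
  have hZcard : Z.card = ∑ u ∈ U, (A u).card * (B u).card := by
    rw [hZ, card_image_of_injective _ (add_left_injective _), card_biUnion]
    · exact sum_congr rfl fun u _ => STPPPackingSumset.card_sub_eq h u (hC u)
    · intro u _ u' _ huu'
      exact STPPPackingSumset.disjoint_sub_sub h huu' (hC u')
  -- each translate avoids every block
  have havoid : ∀ u ∈ U, ∀ d ∈ A u - B u, ∀ w, d + p ∉ A w - B w := by
    intro u hu d hd w hdw
    have hpu := hpU u hu
    by_cases hwu : w = u
    · subst hwu
      rw [mem_sub] at hpu
      obtain ⟨c₁, hc₁, c₂, hc₂, he⟩ := hpu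
      have hne : c₁ ≠ c₂ := fun e => hp0 (by rw [← he, e, sub_self])
      rw [← he] at hdw
      exact not_mem_sub_of_mem_sub_add h w hc₁ hc₂ hne hd hdw
    · have hmem : d + p ∈ (A u - B u) + (C u - C u) := mem_add.2 ⟨d, hd, p, hpu, rfl⟩
      exact disjoint_left.1 (STPPPackingSumset.disjoint_sub_sumset h hwu) hdw hmem
  have hZX : Disjoint Z X := by
    rw [disjoint_left]
    intro x hxZ hxX
    rw [hZ, mem_image] at hxZ
    obtain ⟨d, hd, rfl⟩ := hxZ
    rw [mem_biUnion] at hd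
    obtain ⟨u, hu, hdu⟩ := hd
    rw [hX, mem_image] at hxX
    obtain ⟨d', hd', he⟩ := hxX
    rw [mem_biUnion] at hd'
    obtain ⟨w, -, hdw⟩ := hd'
    have he' : d' = d + p := by
      have := congrArg (· - c₀) he
      simp only [add_sub_cancel_right] at this
      rw [this]; abel
    rw [he'] at hdw
    exact havoid u hu d hdu w hdw
  have hZW : Z ∩ W ⊆ W.filter (fun w => ¬ (w - p ∈ W)) := by
    intro x hx
    rw [mem_inter] at hx
    obtain ⟨hxZ, hxW⟩ := hx
    rw [mem_filter]
    refine ⟨hxW, fun hback => ?_⟩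
    rw [hZ, mem_image] at hxZ
    obtain ⟨d, hd, rfl⟩ := hxZ
    rw [mem_biUnion] at hd
    obtain ⟨u, hu, hdu⟩ := hd
    have hut : u ≠ t := fun e => htU (e ▸ hu)
    have e : d + (p + c₀) - p = d + c₀ := by abel
    rw [e] at hback
    have := hroom _ hback
    rw [add_sub_cancel_right] at this
    exact disjoint_left.1 (STPPPackingSumset.disjoint_sub_sumset h hut) hdu this
  have hpop := STPPIteratedRoom.room_popular h hC t s hs p hpt
  have hsplit := Finset.card_filter_add_card_filter_not (s := W) (fun w => w - p ∈ W)
  have h1 : (Z ∩ W).card ≤ s := by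
    have := card_le_card hZW
    rw [← hW] at hpop
    omega
  have h2 : (Z \ W).card ≤ s := by
    have hsub : Z \ W ⊆ (W ∪ X)ᶜ := by
      intro x hx
      rw [mem_sdiff] at hx
      rw [mem_compl, mem_union, not_or]
      exact ⟨hx.2, fun hxX => disjoint_left.1 hZX hx.1 hxX⟩
    have hc := card_le_card hsub
    rw [card_compl, card_union_of_disjoint hXW.symm, hV, hXcard] at hc
    omega
  have h3 : Z.card = (Z ∩ W).card + (Z \ W).card := (card_inter_add_card_sdiff Z W).symm
  omega

/-- **Common differences, A-form** (rotation `(A,B,C) ↦ (B,C,A)`): with `|G| ≤ V_t + Σ_{w≠t}|B_w||C_w| + s`, a non-zero common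
element of `A_t − A_t` and of all `A_u − A_u`, `u ∈ U` (`t ∉ U`), forces `Σ_{u∈U} |B_u||C_u| ≤ 2s`. [original] -/
theorem sum_card_mul_le_of_common_difference_A (h : IsSTPP A B C) (hA : ∀ w, (A w).Nonempty) (t : Fin N)
    (U : Finset (Fin N)) (htU : t ∉ U) (s : ℕ)
    (hs : Fintype.card G ≤ (A t).card * (B t).card * (C t).card +
      (∑ w ∈ univ.erase t, (B w).card * (C w).card) + s)
    {p : G} (hp0 : p ≠ 0) (hpt : p ∈ A t - A t) (hpU : ∀ u ∈ U, p ∈ A u - A u) :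
    ∑ u ∈ U, (B u).card * (C u).card ≤ 2 * s := by
  have e : (B t).card * (C t).card * (A t).card = (A t).card * (B t).card * (C t).card := by ring
  exact sum_card_mul_le_of_common_difference h.rotate hA t U htU s (by rw [e]; exact hs) hp0 hpt hpU

/-- **Common differences, B-form** (rotation `(A,B,C) ↦ (C,A,B)`): with `|G| ≤ V_t + Σ_{w≠t}|C_w||A_w| + s`, a non-zero common
element of `B_t − B_t` and of all `B_u − B_u`, `u ∈ U` (`t ∉ U`), forces `Σ_{u∈U} |C_u||A_u| ≤ 2s`. [original] -/
theorem sum_card_mul_le_of_common_difference_B (h : IsSTPP A B C) (hB : ∀ w, (B w).Nonempty) (t : Fin N)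
    (U : Finset (Fin N)) (htU : t ∉ U) (s : ℕ)
    (hs : Fintype.card G ≤ (A t).card * (B t).card * (C t).card +
      (∑ w ∈ univ.erase t, (C w).card * (A w).card) + s)
    {p : G} (hp0 : p ≠ 0) (hpt : p ∈ B t - B t) (hpU : ∀ u ∈ U, p ∈ B u - B u) :
    ∑ u ∈ U, (C u).card * (A u).card ≤ 2 * s := by
  have e : (C t).card * (A t).card * (B t).card = (A t).card * (B t).card * (C t).card := by ring
  exact sum_card_mul_le_of_common_difference h.rotate.rotate hB t U htU s (by rw [e]; exact hs) hp0 hpt hpU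

end STPPDifferenceDisjoint

end Summit.MatrixMultiplication.MatrixMultiplication.Theorems
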